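import Summits.ResolutionOfSingularities.ResolutionOfSingularities.Theorems.EquisingularLiftEquisingularLiftNatLiftCoreLocal
import Mathlib.Algebra.Module.SpanRank
import HarnessLib

/-!
# [OURS · L1 W4.5(b) · EL♮] LIFT-50 LOCAL CORE, part 4: the MINIMAL-GENERATOR dictionary — `ϖ ∉ 𝔪·I` ⟺ the special-fibre ideal `I/(ϖ)` needs
# exactly ONE generator FEWER than `I` (crux `EquisingularLiftNat` = stmt-ResolutionOfSingularities-20038; PARENT ≥ 4 band / kill test #50; object (ε))

HONEST FRAMING. OURS (cell res-hironaka, crux chain w45b, slot W4.5(b)); NOT a statement of any manuscript; replaces the role of NOTHING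
in the manuscript; AI-written, AI review is weaker than expert review. Helper `--supports stmt-ResolutionOfSingularities-20038 --as helper`.
Continues `…NatLiftCoreLocal` (p569735). Memo `L/res-L1-w45b-lead-1/LIFT50-CORE.md` §1 «DICTIONARY» (re-derived by hand by res-L1-w45b-tri-2,
TRIAGE v12.9 (d)): in the local ring `A = 𝒪_{P,x}` with `ϖ ∈ I = I_X`, writing `μ` for the minimal number of generators (`Submodule.spanFinrank`)
and `Ī = I·(A/ϖ)` for the ideal of `X` inside the special fibre `F = V(ϖ)`:

* `spanFinrank_map_le`, `spanFinrank_le_spanFinrank_map_add_one` — always `μ(Ī) ≤ μ(I) ≤ μ(Ī) + 1`;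
* `spanFinrank_eq_spanFinrank_map_of_mem_mul` — `ϖ ∈ 𝔪·I ⟹ μ(I) = μ(Ī)` (Nakayama);
* `spanFinrank_eq_spanFinrank_map_add_one_of_not_mem_mul` — `ϖ ∉ 𝔪·I ⟹ μ(I) = μ(Ī) + 1` (drop the generator carrying a unit coefficient of `ϖ`);
* `not_mem_mul_iff_spanFinrank` — THE DICTIONARY: `ϖ ∉ 𝔪·I ⟺ μ(I) = μ(Ī) + 1`. With part 1/2/3: a (regular, for hypersurface-type `X`) `O`-flat local lift exists
  ⟺ `X ↪ F` is cut out by one equation fewer than `X ↪ P` — at a GOOD point this is «`X ↪ F` is lci», automatic; at a BAD point it is the honest condition.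

References: [folklore] (Nakayama; minimal generating sets in local rings); Mathlib `Submodule.spanFinrank`.
-/

set_option linter.dupNamespace false -- mandated namespace `Summit.<Summit>.<Problem>` of this single-conjunct summit

universe u

open IsLocalRing

namespace Summit.ResolutionOfSingularities.ResolutionOfSingularities.Cruxes.EquisingularLiftNat.Sections

namespace LiftCore

variable {A : Type u} [CommRing A] [IsLocalRing A]

omit [IsLocalRing A] in
/-- `μ(Ī) ≤ μ(I)` for the image `Ī` of a finitely generated ideal under any ring map (Mathlib). [folklore] -/
theorem spanFinrank_map_le {B : Type u} [CommRing B] (f : A →+* B) {I : Ideal A} (hI : I.FG) :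
    (I.map f).spanFinrank ≤ I.spanFinrank :=
  Ideal.spanFinrank_map_le_of_fg f hI

omit [IsLocalRing A] in
/-- If `ϖ ∈ I` then `I = J ⊔ (ϖ)` for every `J ≤ I` mapping ONTO `I·(A/ϖ)`; in particular lifting a generating set of `Ī` and adding `ϖ` generates `I`:
`μ(I) ≤ μ(Ī) + 1` (any commutative ring). [folklore] -/
theorem spanFinrank_le_spanFinrank_map_add_one {I : Ideal A} (hI : I.FG) {ϖ : A} (hϖI : ϖ ∈ I) :
    I.spanFinrank ≤ (I.map (Ideal.Quotient.mk (Ideal.span {ϖ}))).spanFinrank + 1 := by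
  classical
  set π := Ideal.Quotient.mk (Ideal.span {ϖ}) with hπ
  obtain ⟨s, hscard, hsspan⟩ := Submodule.FG.exists_span_finset_card_eq_spanFinrank (hI.map π)
  have hsspan' : Ideal.span (s : Set (A ⧸ Ideal.span {ϖ})) = I.map π := hsspan
  -- lift the generators
  have hlift : ∀ y : A ⧸ Ideal.span {ϖ}, ∃ x : A, π x = y := fun y => Ideal.Quotient.mk_surjective y
  choose g hg using hlift
  let t : Finset A := insert ϖ (s.image g)
  have hIt : I = Ideal.span (t : Set A) := by
    apply le_antisymm
    · intro x hx
      have hx' : π x ∈ Ideal.span (s : Set (A ⧸ Ideal.span {ϖ})) := by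
        rw [hsspan']; exact Ideal.mem_map_of_mem π hx
      -- `π x ∈ span s = span (π '' (g '' s))`, so `x ∈ span (g '' s) + ker π`
      have hs_eq : (s : Set (A ⧸ Ideal.span {ϖ})) = π '' ((s.image g : Finset A) : Set A) := by
        ext y
        simp only [Finset.coe_image, Set.mem_image, Finset.mem_coe]
        constructor
        · intro hy; exact ⟨g y, ⟨y, hy, rfl⟩, hg y⟩
        · rintro ⟨x, ⟨y, hy, rfl⟩, rfl⟩; rw [hg y]; exact hy
      rw [hs_eq, ← Ideal.map_span, Ideal.mem_map_iff_of_surjective π Ideal.Quotient.mk_surjective] at hx'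
      obtain ⟨z, hz, hzx⟩ := hx'
      have hker : x - z ∈ Ideal.span {ϖ} := by
        rw [← Ideal.Quotient.eq, ← hπ, hzx]
      have : x = z + (x - z) := by ring
      rw [this]
      refine Ideal.add_mem _ (Ideal.span_mono ?_ hz) (Ideal.span_mono ?_ hker)
      · intro a ha
        simp only [t, Finset.coe_insert]
        exact Set.mem_insert_of_mem _ ha
      · intro a ha
        rw [Set.mem_singleton_iff.mp ha]
        simp only [t, Finset.coe_insert]
        exact Set.mem_insert _ _
    · rw [Ideal.span_le]
      intro a ha
      simp only [t, Finset.coe_insert, Set.mem_insert_iff, Finset.coe_image, Set.mem_image, Finset.mem_coe] at ha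
      rcases ha with rfl | ⟨y, hy, rfl⟩
      · exact hϖI
      · -- `π (g y) = y ∈ Ī`, so `g y ∈ I + (ϖ) = I`
        have hy' : π (g y) ∈ I.map π := by rw [hg y, ← hsspan']; exact Ideal.subset_span hy
        rw [Ideal.mem_map_iff_of_surjective π Ideal.Quotient.mk_surjective] at hy'
        obtain ⟨z, hz, hzy⟩ := hy'
        have hker : g y - z ∈ Ideal.span {ϖ} := by rw [← Ideal.Quotient.eq, ← hπ, hzy]
        have : g y = z + (g y - z) := by ring
        rw [this]
        exact Ideal.add_mem _ hz ((Ideal.span_singleton_le_iff_mem _).mpr hϖI hker)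
  calc I.spanFinrank = (Ideal.span (t : Set A)).spanFinrank := by rw [← hIt]
    _ ≤ (t : Set A).ncard := Submodule.spanFinrank_span_le_ncard_of_finite t.finite_toSet
    _ = t.card := Set.ncard_coe_finset t
    _ ≤ (s.image g).card + 1 := Finset.card_insert_le _ _
    _ ≤ s.card + 1 := by gcongr; exact Finset.card_image_le
    _ = (I.map π).spanFinrank + 1 := by rw [hscard]

/-- **`ϖ ∈ 𝔪·I ⟹ μ(I) = μ(Ī)`** (Nakayama: `I = (lifts) + (ϖ) ⊆ (lifts) + 𝔪 I`). [folklore] -/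
theorem spanFinrank_eq_spanFinrank_map_of_mem_mul {I : Ideal A} (hI : I.FG) {ϖ : A}
    (hϖ : ϖ ∈ maximalIdeal A * I) :
    I.spanFinrank = (I.map (Ideal.Quotient.mk (Ideal.span {ϖ}))).spanFinrank := by
  classical
  set π := Ideal.Quotient.mk (Ideal.span {ϖ}) with hπ
  have hϖI : ϖ ∈ I := Ideal.mul_le_left hϖ
  refine le_antisymm ?_ (spanFinrank_map_le π hI)
  obtain ⟨s, hscard, hsspan⟩ := Submodule.FG.exists_span_finset_card_eq_spanFinrank (hI.map π)
  have hsspan' : Ideal.span (s : Set (A ⧸ Ideal.span {ϖ})) = I.map π := hsspan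
  choose g hg using fun y : A ⧸ Ideal.span {ϖ} => Ideal.Quotient.mk_surjective y
  let t : Finset A := s.image g
  -- `J := span t ≤ I` and `I ≤ J + (ϖ) ≤ J + 𝔪 I`
  have hJI : Ideal.span (t : Set A) ≤ I := by
    rw [Ideal.span_le]
    intro a ha
    simp only [t, Finset.coe_image, Set.mem_image, Finset.mem_coe] at ha
    obtain ⟨y, hy, rfl⟩ := ha
    have hy' : π (g y) ∈ I.map π := by rw [hg y, ← hsspan']; exact Ideal.subset_span hy
    rw [Ideal.mem_map_iff_of_surjective π Ideal.Quotient.mk_surjective] at hy'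
    obtain ⟨z, hz, hzy⟩ := hy'
    have hker : g y - z ∈ Ideal.span {ϖ} := by rw [← Ideal.Quotient.eq, ← hπ, hzy]
    have : g y = z + (g y - z) := by ring
    rw [this]
    exact Ideal.add_mem _ hz ((Ideal.span_singleton_le_iff_mem _).mpr hϖI hker)
  have hIJ : I ≤ Ideal.span (t : Set A) ⊔ maximalIdeal A • I := by
    intro x hx
    have hx' : π x ∈ Ideal.span (s : Set (A ⧸ Ideal.span {ϖ})) := by
      rw [hsspan']; exact Ideal.mem_map_of_mem π hx
    have hs_eq : (s : Set (A ⧸ Ideal.span {ϖ})) = π '' ((t : Finset A) : Set A) := by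
      ext y
      simp only [t, Finset.coe_image, Set.mem_image, Finset.mem_coe]
      constructor
      · intro hy; exact ⟨g y, ⟨y, hy, rfl⟩, hg y⟩
      · rintro ⟨x, ⟨y, hy, rfl⟩, rfl⟩; rw [hg y]; exact hy
    rw [hs_eq, ← Ideal.map_span, Ideal.mem_map_iff_of_surjective π Ideal.Quotient.mk_surjective] at hx'
    obtain ⟨z, hz, hzx⟩ := hx'
    have hker : x - z ∈ Ideal.span {ϖ} := by rw [← Ideal.Quotient.eq, ← hπ, hzx]
    obtain ⟨a, ha⟩ := Ideal.mem_span_singleton'.mp hker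
    have : x = z + a * ϖ := by rw [ha]; ring
    rw [this, Ideal.smul_eq_mul]
    exact Ideal.add_mem _ (Ideal.mem_sup_left hz) (Ideal.mem_sup_right (Ideal.mul_mem_left _ _ hϖ))
  have hIeq : I = Ideal.span (t : Set A) :=
    le_antisymm (Submodule.le_of_le_smul_of_le_jacobson_bot hI (IsLocalRing.maximalIdeal_le_jacobson ⊥) hIJ) hJI
  calc I.spanFinrank = (Ideal.span (t : Set A)).spanFinrank := by rw [← hIeq]
    _ ≤ (t : Set A).ncard := Submodule.spanFinrank_span_le_ncard_of_finite t.finite_toSet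
    _ = t.card := Set.ncard_coe_finset t
    _ ≤ s.card := Finset.card_image_le
    _ = (I.map π).spanFinrank := hscard

/-- **`ϖ ∉ 𝔪·I ⟹ μ(I) = μ(Ī) + 1`**: in a minimal generating set `t` of `I` write `ϖ = Σ aᵢ tᵢ`; some `aᵢ₀` is a unit, so `I = (t ∖ tᵢ₀) + (ϖ)` and
`Ī` is generated by the `μ(I) − 1` images of `t ∖ tᵢ₀`. [folklore] -/
theorem spanFinrank_eq_spanFinrank_map_add_one_of_not_mem_mul {I : Ideal A} (hI : I.FG) {ϖ : A} (hϖI : ϖ ∈ I)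
    (hϖ : ϖ ∉ maximalIdeal A * I) :
    I.spanFinrank = (I.map (Ideal.Quotient.mk (Ideal.span {ϖ}))).spanFinrank + 1 := by
  classical
  set π := Ideal.Quotient.mk (Ideal.span {ϖ}) with hπ
  refine le_antisymm (spanFinrank_le_spanFinrank_map_add_one hI hϖI) ?_
  obtain ⟨t, htcard, htspan⟩ := Submodule.FG.exists_span_finset_card_eq_spanFinrank hI
  have htspan' : Ideal.span (t : Set A) = I := htspan
  -- `ϖ = Σ a_x x` over `t`
  have hϖt : ϖ ∈ Ideal.span (t : Set A) := by rw [htspan']; exact hϖI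
  obtain ⟨a, -, ha⟩ := (Submodule.mem_span_finset (s := t) (x := ϖ)).mp hϖt
  simp only [smul_eq_mul] at ha
  -- some coefficient is a unit
  obtain ⟨x₀, hx₀t, hx₀⟩ : ∃ x₀ ∈ t, a x₀ ∉ maximalIdeal A := by
    by_contra hall
    push Not at hall
    apply hϖ
    rw [← ha]
    exact Ideal.sum_mem _ fun x hx => Ideal.mul_mem_mul (hall x hx) (htspan' ▸ Ideal.subset_span hx)
  have hu : IsUnit (a x₀) := (IsLocalRing.notMem_maximalIdeal).mp hx₀
  let t' : Finset A := t.erase x₀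
  -- `x₀ ∈ span t' + (ϖ)`
  have hsplit : a x₀ * x₀ + ∑ x ∈ t', a x * x = ϖ := by
    rw [← ha, ← Finset.add_sum_erase t (fun x => a x * x) hx₀t]
  have hx₀mem : x₀ ∈ Ideal.span (t' : Set A) ⊔ Ideal.span {ϖ} := by
    have h1 : a x₀ * x₀ ∈ Ideal.span (t' : Set A) ⊔ Ideal.span {ϖ} := by
      have : a x₀ * x₀ = ϖ - ∑ x ∈ t', a x * x := by rw [← hsplit]; ring
      rw [this]
      refine Ideal.sub_mem _ (Ideal.mem_sup_right (Ideal.mem_span_singleton_self ϖ))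
        (Ideal.mem_sup_left (Ideal.sum_mem _ fun x hx => Ideal.mul_mem_left _ _ (Ideal.subset_span hx)))
    have : x₀ = ↑hu.unit⁻¹ * (a x₀ * x₀) := by rw [← mul_assoc, IsUnit.val_inv_mul, one_mul]
    rw [this]; exact Ideal.mul_mem_left _ _ h1
  -- hence `I = span t' + (ϖ)` and `Ī = span (π '' t')`
  have hIle : I ≤ Ideal.span (t' : Set A) ⊔ Ideal.span {ϖ} := by
    rw [← htspan', Ideal.span_le]
    intro x hx
    by_cases hxx : x = x₀
    · subst hxx; exact hx₀mem
    · exact Ideal.mem_sup_left (Ideal.subset_span (Finset.mem_erase.mpr ⟨hxx, hx⟩))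
  have hmaple : I.map π ≤ Ideal.span (π '' (t' : Set A)) := by
    rw [← Ideal.map_span]
    refine (Ideal.map_mono hIle).trans ?_
    rw [Ideal.map_sup]
    refine sup_le le_rfl ?_
    rw [Ideal.map_span, Set.image_singleton, Ideal.span_singleton_le_iff_mem, hπ, Ideal.Quotient.eq_zero_iff_mem.mpr
      (Ideal.mem_span_singleton_self ϖ)]
    exact Ideal.zero_mem _
  have hmapge : Ideal.span (π '' (t' : Set A)) ≤ I.map π := by
    rw [← Ideal.map_span]
    exact Ideal.map_mono ((Ideal.span_mono (Finset.coe_subset.mpr (Finset.erase_subset x₀ t))).trans htspan'.le)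
  have hmapeq : I.map π = Ideal.span (π '' (t' : Set A)) := le_antisymm hmaple hmapge
  have hcard' : t'.card + 1 = t.card := Finset.card_erase_add_one hx₀t
  calc (I.map π).spanFinrank + 1 = (Ideal.span (π '' (t' : Set A))).spanFinrank + 1 := by rw [hmapeq]
    _ ≤ (π '' (t' : Set A)).ncard + 1 := by
        gcongr; exact Submodule.spanFinrank_span_le_ncard_of_finite (t'.finite_toSet.image π)
    _ ≤ (t' : Set A).ncard + 1 := by gcongr; exact Set.ncard_image_le t'.finite_toSet
    _ = t'.card + 1 := by rw [Set.ncard_coe_finset]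
    _ = t.card := hcard'
    _ = I.spanFinrank := htcard

/-- **THE MINIMAL-GENERATOR DICTIONARY.** For a finitely generated ideal `I ∋ ϖ` of a local ring: `ϖ ∉ 𝔪·I ⟺ μ(I) = μ(I·(A/ϖ)) + 1`, i.e. the
special-fibre ideal of `X` needs exactly one generator fewer than its ideal in the ambient. Combined with parts 1–3: this is the liftability criterion
of LIFT50-CORE §1 in the «one equation fewer / lci» currency. OURS. [folklore] -/
theorem not_mem_mul_iff_spanFinrank {I : Ideal A} (hI : I.FG) {ϖ : A} (hϖI : ϖ ∈ I) :
    ϖ ∉ maximalIdeal A * I ↔ I.spanFinrank = (I.map (Ideal.Quotient.mk (Ideal.span {ϖ}))).spanFinrank + 1 := by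
  constructor
  · exact spanFinrank_eq_spanFinrank_map_add_one_of_not_mem_mul hI hϖI
  · intro h hmem
    have := spanFinrank_eq_spanFinrank_map_of_mem_mul hI hmem
    omega

end LiftCore

end Summit.ResolutionOfSingularities.ResolutionOfSingularities.Cruxes.EquisingularLiftNat.Sections
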